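import Literature.Analysis.FunctionSpaces.TimeMollification
import HarnessLib

/-!
# The mollified pairing limit for an `L¹(0,t;L²)` field against an `L^∞(0,t;L²)` field

Analysis/FunctionSpaces toolkit file, companion of `TimeMollification.lean`. The accepted
`Literature.Analysis.FunctionSpaces.tendsto_integral_normed_mul_integral_inner` (Serrin 1963, §4)
passes to the limit `h → 0` in the time-mollified pairing
`∫∫_{(0,t)²} ρₙ(s - σ) ⟨Φ(s), A(σ)⟩_{L²(X)} dσ ds → ∫_{(0,t)} ⟨Φ(s), A(s)⟩ ds` for `Φ, A` BOTH square
integrable on `(0,t) × X`. For the FORCE term of the forced Navier–Stokes energy/uniqueness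
arguments in Sohr's printed class — `f = f₀` with `f₀ ∈ L¹(0,T; L²(Ω)ⁿ)` (Sohr 2001, Ch. V,
(1.4.2)/(1.5.1), Thms. 1.4.1 and 1.5.1), paired with a weak solution `u ∈ L^∞(0,T; L²_σ)` — one
factor is only `L¹` in time and the other is essentially bounded in time. This file proves that
case:

**Main result** (`tendsto_integral_normed_mul_integral_inner_L1`). Let `Φ, A : ℝ × X → V` be
jointly (strongly) measurable with `∫_{(0,t)} ‖Φ(s)‖_{L²(X)} ds < ∞` and `‖A(σ)‖_{L²(X)} ≤ C < ∞`
for a.e. `σ ∈ (0,t)`, and let `ρₙ` be normalised bump kernels with `rOut(ρₙ) → 0`. Then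
`∫∫_{(0,t)²} ρₙ(s - σ) (∫ₓ ⟪Φ(s), A(σ)⟫) dσ ds → ∫_{(0,t)} ∫ₓ ⟪Φ(s), A(s)⟫ ds`.

Proof: truncate `Φ` IN TIME at the slice-norm level `M`, `Φ_M(s) = Φ(s)·𝟙{‖Φ(s)‖₂ ≤ M}`; then
`Φ_M ∈ L²((0,t) × X)` (`‖Φ_M‖² ≤ M ∫‖Φ(s)‖₂`) and the accepted `L²`–`L²` lemma applies to
`(Φ_M, A)`; the two error terms are bounded, uniformly in `n`, by `C ∫_{‖Φ(s)‖₂ > M} ‖Φ(s)‖₂ ds`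
(because `ρₙ ≥ 0` has unit mass in `σ`, Serrin's weighted Young inequality in its simplest form),
which tends to `0` as `M → ∞` by dominated convergence. The statement is given with the limit in
iterated form (`∫_{(0,t)} ∫ₓ`), which is how the cross-identity files of the tree consume it.

## Mathlib / tree search

Mathlib has no time-mollification API. Tree: `TimeMollification.lean` (the `L²`–`L²` case and the
kernel lemmas `lintegral_ofReal_normed_sub_left/right`, `exists_normed_le`, `normed_sub_comm`);
`lean search 'tendsto_integral_normed'` finds only the `L²`–`L²` versions.

## References

* J. Serrin, *The initial value problem for the Navier–Stokes equations*, in: Nonlinear Problems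
  (Madison 1962), Univ. Wisconsin Press 1963, §4 (`Serrin1963`).
* H. Sohr, *The Navier–Stokes Equations. An Elementary Functional Analytic Approach*, Birkhäuser
  2001, Ch. IV §1.2 (`L^s(0,T;X)`), Ch. V (1.4.2), Thm. 1.4.1, Thm. 1.5.1 (`Sohr2001`).
-/

noncomputable section

open MeasureTheory TopologicalSpace Set Function Filter Topology
open scoped ENNReal NNReal InnerProductSpace RealInnerProductSpace

namespace Literature.Analysis.FunctionSpaces

variable {X : Type*} [MeasurableSpace X] {μ : Measure X} [SFinite μ]
variable {V : Type*} [NormedAddCommGroup V] [InnerProductSpace ℝ V] [CompleteSpace V]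

section L1Linfty

variable {t : ℝ} {A Φ : ℝ → X → V}

omit [InnerProductSpace ℝ V] [CompleteSpace V] in
/-- **Time truncation at a slice-norm level.** For a jointly measurable `Φ` and `M`, the field
`Φ_M(s,x) = Φ(s,x)` if `‖Φ(s)‖_{L²} ≤ M` and `0` otherwise is jointly measurable (it is the
indicator of the measurable time set `{s | ‖Φ(s)‖₂ ≤ M}` times `Φ`; Sohr 2001, Ch. IV §1.2, step
functions of `L¹(0,T;X)`). [cite: Sohr2001, Ch. IV §1.2] -/
theorem stronglyMeasurable_uncurry_sliceTrunc (hΦ : StronglyMeasurable (uncurry Φ)) (M : ℝ≥0∞) :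
    StronglyMeasurable (uncurry fun s x => if eLpNorm (Φ s) 2 μ ≤ M then Φ s x else 0) := by
  have hS : MeasurableSet {z : ℝ × X | eLpNorm (Φ z.1) 2 μ ≤ M} :=
    measurableSet_le ((measurable_eLpNorm_slice hΦ 2).comp measurable_fst) measurable_const
  have heq : (uncurry fun s x => if eLpNorm (Φ s) 2 μ ≤ M then Φ s x else 0) =
      {z : ℝ × X | eLpNorm (Φ z.1) 2 μ ≤ M}.indicator (uncurry Φ) := by
    ext z
    simp only [uncurry, indicator_apply, mem_setOf_eq]
  rw [heq]
  exact hΦ.indicator hS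

omit [InnerProductSpace ℝ V] [CompleteSpace V] [SFinite μ] in
/-- The slice norms of the time truncation: `‖Φ_M(s)‖₂ = ‖Φ(s)‖₂` if `‖Φ(s)‖₂ ≤ M`, else `0`.
[cite: Sohr2001, Ch. IV §1.2] -/
theorem eLpNorm_sliceTrunc (Φ : ℝ → X → V) (M : ℝ≥0∞) (s : ℝ) :
    eLpNorm (fun x => if eLpNorm (Φ s) 2 μ ≤ M then Φ s x else 0) 2 μ =
      if eLpNorm (Φ s) 2 μ ≤ M then eLpNorm (Φ s) 2 μ else 0 := by
  by_cases h : eLpNorm (Φ s) 2 μ ≤ M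
  · simp only [h, if_true]
  · simp only [h, if_false, eLpNorm_zero']

omit [InnerProductSpace ℝ V] [CompleteSpace V] [SFinite μ] in
/-- The slice norms of the truncation remainder: `‖Φ(s) - Φ_M(s)‖₂ = 0` if `‖Φ(s)‖₂ ≤ M`, else
`‖Φ(s)‖₂`. [cite: Sohr2001, Ch. IV §1.2] -/
theorem eLpNorm_sub_sliceTrunc (Φ : ℝ → X → V) (M : ℝ≥0∞) (s : ℝ) :
    eLpNorm (fun x => Φ s x - if eLpNorm (Φ s) 2 μ ≤ M then Φ s x else 0) 2 μ =
      if eLpNorm (Φ s) 2 μ ≤ M then 0 else eLpNorm (Φ s) 2 μ := by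
  by_cases h : eLpNorm (Φ s) 2 μ ≤ M
  · simp only [h, if_true, sub_self, eLpNorm_zero']
  · simp only [h, if_false, sub_zero]

omit [InnerProductSpace ℝ V] [CompleteSpace V] in
/-- The time truncation at level `M < ∞` of an `L¹(0,t;L²)` field is in `L²((0,t) × X)`:
`‖Φ_M‖²_{L²} = ∫_{‖Φ(s)‖₂ ≤ M} ‖Φ(s)‖₂² ≤ M ∫ ‖Φ(s)‖₂ ds`. [cite: Sohr2001, Ch. IV §1.2] -/
theorem eLpNorm_uncurry_sliceTrunc_lt_top (hΦ : StronglyMeasurable (uncurry Φ))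
    (hΦ1 : ∫⁻ s in Ioo 0 t, eLpNorm (Φ s) 2 μ < ⊤) {M : ℝ≥0∞} (hM : M ≠ ⊤) :
    eLpNorm (uncurry fun s x => if eLpNorm (Φ s) 2 μ ≤ M then Φ s x else 0) 2
      ((volume.restrict (Ioo 0 t)).prod μ) < ⊤ := by
  have hsq := lintegral_eLpNorm_slice_sq (μ := μ) (ν := volume.restrict (Ioo 0 t))
    (A := fun s x => if eLpNorm (Φ s) 2 μ ≤ M then Φ s x else 0)
    (stronglyMeasurable_uncurry_sliceTrunc hΦ M)
  have hb : ∫⁻ s in Ioo 0 t, eLpNorm (fun x => if eLpNorm (Φ s) 2 μ ≤ M then Φ s x else 0) 2 μ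
      ^ (2 : ℝ) ≤ M * ∫⁻ s in Ioo 0 t, eLpNorm (Φ s) 2 μ := by
    rw [← lintegral_const_mul' _ _ hM]
    refine lintegral_mono fun s => ?_
    rw [eLpNorm_sliceTrunc]
    by_cases h : eLpNorm (Φ s) 2 μ ≤ M
    · rw [if_pos h, ENNReal.rpow_two, sq]
      exact mul_le_mul' h le_rfl
    · rw [if_neg h, ENNReal.zero_rpow_of_pos zero_lt_two]
      exact bot_le
  rw [hsq] at hb
  have hfin : eLpNorm (uncurry fun s x => if eLpNorm (Φ s) 2 μ ≤ M then Φ s x else 0) 2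
      ((volume.restrict (Ioo 0 t)).prod μ) ^ (2 : ℝ) < ⊤ :=
    lt_of_le_of_lt hb (ENNReal.mul_lt_top hM.lt_top hΦ1)
  exact (ENNReal.rpow_lt_top_iff_of_pos zero_lt_two).1 hfin

omit [InnerProductSpace ℝ V] [CompleteSpace V] in
/-- An `L^∞(0,t;L²)` field on a bounded interval is in `L²((0,t) × X)`:
`‖A‖²_{L²((0,t)×X)} = ∫_{(0,t)} ‖A(σ)‖₂² ≤ C² · t`. [cite: Sohr2001, Ch. IV §1.2] -/
theorem eLpNorm_uncurry_lt_top_of_ae_slice_le (hA : StronglyMeasurable (uncurry A))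
    {C : ℝ≥0∞} (hC : C ≠ ⊤) (hAC : ∀ᵐ σ ∂(volume.restrict (Ioo 0 t)), eLpNorm (A σ) 2 μ ≤ C) :
    eLpNorm (uncurry A) 2 ((volume.restrict (Ioo 0 t)).prod μ) < ⊤ := by
  have hsq := lintegral_eLpNorm_slice_sq (μ := μ) (ν := volume.restrict (Ioo 0 t)) (A := A) hA
  have hb : ∫⁻ σ in Ioo 0 t, eLpNorm (A σ) 2 μ ^ (2 : ℝ) ≤ C ^ (2 : ℝ) * volume (Ioo (0 : ℝ) t) := by
    calc ∫⁻ σ in Ioo 0 t, eLpNorm (A σ) 2 μ ^ (2 : ℝ) ≤ ∫⁻ σ in Ioo 0 t, C ^ (2 : ℝ) :=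
          lintegral_mono_ae (hAC.mono fun σ hσ => ENNReal.rpow_le_rpow hσ zero_le_two)
      _ = C ^ (2 : ℝ) * volume (Ioo (0 : ℝ) t) := by
          rw [lintegral_const, Measure.restrict_apply_univ]
  rw [hsq] at hb
  have : (uncurry fun s x => A s x) = uncurry A := rfl
  have hfin : eLpNorm (uncurry A) 2 ((volume.restrict (Ioo 0 t)).prod μ) ^ (2 : ℝ) < ⊤ := by
    refine lt_of_le_of_lt hb (ENNReal.mul_lt_top (ENNReal.rpow_lt_top_of_nonneg zero_le_two hC) ?_)
    rw [Real.volume_Ioo]; exact ENNReal.ofReal_lt_top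
  exact (ENNReal.rpow_lt_top_iff_of_pos zero_lt_two).1 hfin

omit [CompleteSpace V] in
/-- **Square integrability of the kernel-weighted `L¹`–`L^∞` pairing.** For jointly measurable
`Ψ ∈ L¹(0,t;L²)` and `A` with `‖A(σ)‖₂ ≤ C < ∞` a.e., `(σ,s) ↦ ρ(s-σ) ∫ₓ⟪Ψ(s), A(σ)⟫` is
integrable on `(0,t)²` (`|ρ(s-σ)∫⟪Ψ(s),A(σ)⟫| ≤ sup ρ · C · ‖Ψ(s)‖₂` a.e.). [cite: Serrin1963, §4] -/
theorem integrable_sq_normed_mul_integral_inner_L1 (φ : ContDiffBump (0 : ℝ))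
    (hA : StronglyMeasurable (uncurry A)) (hΨ : StronglyMeasurable (uncurry Φ))
    {C : ℝ≥0∞} (hC : C ≠ ⊤) (hAC : ∀ᵐ σ ∂(volume.restrict (Ioo 0 t)), eLpNorm (A σ) 2 μ ≤ C)
    (hΦ1 : ∫⁻ s in Ioo 0 t, eLpNorm (Φ s) 2 μ < ⊤) :
    Integrable (fun p : ℝ × ℝ => φ.normed volume (p.2 - p.1) * ∫ x, ⟪Φ p.2 x, A p.1 x⟫ ∂μ)
      ((volume.restrict (Ioo 0 t)).prod (volume.restrict (Ioo 0 t))) := by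
  set νt : Measure ℝ := volume.restrict (Ioo 0 t) with hνt
  haveI : IsFiniteMeasure νt := by rw [hνt]; infer_instance
  obtain ⟨Cρ, hCρ0, hCρ⟩ := exists_normed_le φ
  -- measurability
  have hIm : StronglyMeasurable fun p : ℝ × ℝ => ∫ x, ⟪Φ p.2 x, A p.1 x⟫ ∂μ := by
    have h : StronglyMeasurable fun q : (ℝ × ℝ) × X => ⟪Φ q.1.2 q.2, A q.1.1 q.2⟫ :=
      (hΨ.comp_measurable (measurable_fst.snd.prodMk measurable_snd)).inner (𝕜 := ℝ)
        (hA.comp_measurable (measurable_fst.fst.prodMk measurable_snd))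
    exact h.integral_prod_right'
  have hm : AEStronglyMeasurable
      (fun p : ℝ × ℝ => φ.normed volume (p.2 - p.1) * ∫ x, ⟪Φ p.2 x, A p.1 x⟫ ∂μ) (νt.prod νt) :=
    ((φ.continuous_normed.comp (continuous_snd.sub continuous_fst)).aestronglyMeasurable).mul
      hIm.aestronglyMeasurable
  -- the dominating function `Cρ * C * ‖Φ(s)‖₂`
  have hbm : Measurable fun s => eLpNorm (Φ s) 2 μ := measurable_eLpNorm_slice hΨ 2
  have hbi : Integrable (fun s => (eLpNorm (Φ s) 2 μ).toReal) νt :=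
    integrable_toReal_of_lintegral_ne_top hbm.aemeasurable hΦ1.ne
  have hb_fin : ∀ᵐ s ∂νt, eLpNorm (Φ s) 2 μ < ⊤ := ae_lt_top hbm hΦ1.ne
  refine Integrable.mono' (((integrable_const (1 : ℝ)).mul_prod hbi).const_mul (Cρ * C.toReal)) hm ?_
  have h1 : ∀ᵐ p ∂(νt.prod νt), eLpNorm (A p.1) 2 μ ≤ C :=
    (Measure.quasiMeasurePreserving_fst (μ := νt) (ν := νt)).ae hAC
  have h2 : ∀ᵐ p ∂(νt.prod νt), eLpNorm (Φ p.2) 2 μ < ⊤ :=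
    (Measure.quasiMeasurePreserving_snd (μ := νt) (ν := νt)).ae hb_fin
  filter_upwards [h1, h2] with p hp1 hp2
  rw [norm_mul, Real.norm_eq_abs, abs_of_nonneg (φ.nonneg_normed _), one_mul]
  have hI : ‖∫ x, ⟪Φ p.2 x, A p.1 x⟫ ∂μ‖ ≤ (eLpNorm (Φ p.2) 2 μ).toReal * C.toReal := by
    rw [← toReal_enorm, ← ENNReal.toReal_mul]
    refine ENNReal.toReal_mono (ENNReal.mul_ne_top hp2.ne hC) ?_
    exact (enorm_integral_inner_le_eLpNorm_mul (hΨ.of_uncurry_left (x := p.2)).aestronglyMeasurable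
      (hA.of_uncurry_left (x := p.1)).aestronglyMeasurable).trans (mul_le_mul' le_rfl hp1)
  calc φ.normed volume (p.2 - p.1) * ‖∫ x, ⟪Φ p.2 x, A p.1 x⟫ ∂μ‖
      ≤ Cρ * ((eLpNorm (Φ p.2) 2 μ).toReal * C.toReal) :=
        mul_le_mul (hCρ _) hI (norm_nonneg _) hCρ0
    _ = Cρ * C.toReal * (eLpNorm (Φ p.2) 2 μ).toReal := by ring

omit [CompleteSpace V] in
/-- **Integrability of the diagonal `L¹`–`L^∞` pairing**: `s ↦ ∫ₓ⟪Φ(s), A(s)⟫` is integrable on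
`(0,t)` when `Φ ∈ L¹(0,t;L²)` and `‖A(σ)‖₂ ≤ C < ∞` a.e. (`|∫⟪Φ(s),A(s)⟫| ≤ C‖Φ(s)‖₂`).
[cite: Serrin1963, §4] -/
theorem integrableOn_integral_inner_L1 (hA : StronglyMeasurable (uncurry A))
    (hΨ : StronglyMeasurable (uncurry Φ)) {C : ℝ≥0∞} (hC : C ≠ ⊤)
    (hAC : ∀ᵐ σ ∂(volume.restrict (Ioo 0 t)), eLpNorm (A σ) 2 μ ≤ C)
    (hΦ1 : ∫⁻ s in Ioo 0 t, eLpNorm (Φ s) 2 μ < ⊤) :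
    IntegrableOn (fun s => ∫ x, ⟪Φ s x, A s x⟫ ∂μ) (Ioo 0 t) := by
  have hm : StronglyMeasurable fun s => ∫ x, ⟪Φ s x, A s x⟫ ∂μ := by
    have h : StronglyMeasurable fun q : ℝ × X => ⟪Φ q.1 q.2, A q.1 q.2⟫ := hΨ.inner (𝕜 := ℝ) hA
    exact h.integral_prod_right'
  refine ⟨hm.aestronglyMeasurable, ?_⟩
  have hbound : ∀ᵐ s ∂(volume.restrict (Ioo 0 t)),
      ‖∫ x, ⟪Φ s x, A s x⟫ ∂μ‖ₑ ≤ eLpNorm (Φ s) 2 μ * C := by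
    filter_upwards [hAC] with s hs
    exact (enorm_integral_inner_le_eLpNorm_mul (hΨ.of_uncurry_left (x := s)).aestronglyMeasurable
      (hA.of_uncurry_left (x := s)).aestronglyMeasurable).trans (mul_le_mul' le_rfl hs)
  calc ∫⁻ s in Ioo 0 t, ‖∫ x, ⟪Φ s x, A s x⟫ ∂μ‖ₑ
      ≤ ∫⁻ s in Ioo 0 t, eLpNorm (Φ s) 2 μ * C := lintegral_mono_ae hbound
    _ = (∫⁻ s in Ioo 0 t, eLpNorm (Φ s) 2 μ) * C :=
        lintegral_mul_const _ (measurable_eLpNorm_slice hΨ 2)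
    _ < ⊤ := ENNReal.mul_lt_top hΦ1 hC.lt_top

omit [CompleteSpace V] in
/-- **The uniform error bound** (Serrin's weighted Young inequality in its simplest form): for
`Ψ ∈ L¹(0,t;L²)`, `‖A(σ)‖₂ ≤ C` a.e. and ANY normalised bump `ρ`,
`‖∫∫_{(0,t)²} ρ(s-σ) ∫ₓ⟪Ψ(s), A(σ)⟫‖ ≤ C ∫_{(0,t)} ‖Ψ(s)‖₂ ds` — because `ρ ≥ 0` and
`∫ ρ(s-σ) dσ ≤ 1`. [cite: Serrin1963, §4] -/
theorem enorm_integral_sq_normed_mul_integral_inner_le (φ : ContDiffBump (0 : ℝ))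
    (hA : StronglyMeasurable (uncurry A)) (hΨ : StronglyMeasurable (uncurry Φ))
    {C : ℝ≥0∞} (hAC : ∀ᵐ σ ∂(volume.restrict (Ioo 0 t)), eLpNorm (A σ) 2 μ ≤ C) :
    ‖∫ p, φ.normed volume (p.2 - p.1) * ∫ x, ⟪Φ p.2 x, A p.1 x⟫ ∂μ
        ∂((volume.restrict (Ioo 0 t)).prod (volume.restrict (Ioo 0 t)))‖ₑ ≤
      C * ∫⁻ s in Ioo 0 t, eLpNorm (Φ s) 2 μ := by
  set νt : Measure ℝ := volume.restrict (Ioo 0 t) with hνt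
  set K : ℝ × ℝ → ℝ≥0∞ := fun p => ENNReal.ofReal (φ.normed volume (p.2 - p.1)) with hK
  have hKm : Measurable K :=
    ENNReal.measurable_ofReal.comp (φ.continuous_normed.measurable.comp (measurable_snd.sub measurable_fst))
  have hbm : Measurable fun s => eLpNorm (Φ s) 2 μ := measurable_eLpNorm_slice hΨ 2
  have ham : Measurable fun σ => eLpNorm (A σ) 2 μ := measurable_eLpNorm_slice hA 2
  -- pointwise bound of the integrand
  have hpt : ∀ p : ℝ × ℝ, ‖φ.normed volume (p.2 - p.1) * ∫ x, ⟪Φ p.2 x, A p.1 x⟫ ∂μ‖ₑ ≤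
      K p * (eLpNorm (Φ p.2) 2 μ * eLpNorm (A p.1) 2 μ) := by
    intro p
    rw [enorm_mul, Real.enorm_eq_ofReal (φ.nonneg_normed _)]
    exact mul_le_mul' le_rfl (enorm_integral_inner_le_eLpNorm_mul
      (hΨ.of_uncurry_left (x := p.2)).aestronglyMeasurable
      (hA.of_uncurry_left (x := p.1)).aestronglyMeasurable)
  -- unit mass of the kernel in `σ` over `(0,t)`
  have hK1 : ∀ s, ∫⁻ σ, K (σ, s) ∂νt ≤ 1 := fun s =>
    (lintegral_mono' (Measure.restrict_le_self) le_rfl).trans (lintegral_ofReal_normed_sub_left φ s).le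
  calc ‖∫ p, φ.normed volume (p.2 - p.1) * ∫ x, ⟪Φ p.2 x, A p.1 x⟫ ∂μ ∂(νt.prod νt)‖ₑ
      ≤ ∫⁻ p, ‖φ.normed volume (p.2 - p.1) * ∫ x, ⟪Φ p.2 x, A p.1 x⟫ ∂μ‖ₑ ∂(νt.prod νt) :=
        enorm_integral_le_lintegral_enorm _
    _ ≤ ∫⁻ p, K p * (eLpNorm (Φ p.2) 2 μ * eLpNorm (A p.1) 2 μ) ∂(νt.prod νt) :=
        lintegral_mono fun p => hpt p
    _ = ∫⁻ σ, ∫⁻ s, K (σ, s) * (eLpNorm (Φ s) 2 μ * eLpNorm (A σ) 2 μ) ∂νt ∂νt := by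
        have hm2 : Measurable fun p : ℝ × ℝ => K p * (eLpNorm (Φ p.2) 2 μ * eLpNorm (A p.1) 2 μ) :=
          hKm.mul ((hbm.comp measurable_snd).mul (ham.comp measurable_fst))
        rw [lintegral_prod _ hm2.aemeasurable]
    _ ≤ ∫⁻ σ, ∫⁻ s, K (σ, s) * (eLpNorm (Φ s) 2 μ * C) ∂νt ∂νt := by
        refine lintegral_mono_ae ?_
        filter_upwards [hAC] with σ hσ
        exact lintegral_mono fun s => mul_le_mul' le_rfl (mul_le_mul' le_rfl hσ)
    _ = ∫⁻ s, ∫⁻ σ, K (σ, s) * (eLpNorm (Φ s) 2 μ * C) ∂νt ∂νt := by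
        have hm3 : Measurable fun p : ℝ × ℝ => K p * (eLpNorm (Φ p.2) 2 μ * C) :=
          hKm.mul ((hbm.comp measurable_snd).mul measurable_const)
        exact lintegral_lintegral_swap hm3.aemeasurable
    _ = ∫⁻ s, (∫⁻ σ, K (σ, s) ∂νt) * (eLpNorm (Φ s) 2 μ * C) ∂νt := by
        refine lintegral_congr fun s => ?_
        exact lintegral_mul_const _ (hKm.comp measurable_prodMk_right)
    _ ≤ ∫⁻ s, eLpNorm (Φ s) 2 μ * C ∂νt :=
        lintegral_mono fun s => mul_le_of_le_one_left' (hK1 s)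
    _ = C * ∫⁻ s, eLpNorm (Φ s) 2 μ ∂νt := by
        rw [lintegral_mul_const _ hbm, mul_comm]

omit [CompleteSpace V] in
/-- The diagonal analogue of the error bound: `‖∫_{(0,t)} ∫ₓ⟪Ψ(s), A(s)⟫‖ ≤ C ∫_{(0,t)}‖Ψ(s)‖₂`.
[cite: Serrin1963, §4] -/
theorem enorm_integral_integral_inner_le (hA : StronglyMeasurable (uncurry A))
    (hΨ : StronglyMeasurable (uncurry Φ)) {C : ℝ≥0∞}
    (hAC : ∀ᵐ σ ∂(volume.restrict (Ioo 0 t)), eLpNorm (A σ) 2 μ ≤ C) :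
    ‖∫ s in Ioo 0 t, ∫ x, ⟪Φ s x, A s x⟫ ∂μ‖ₑ ≤ C * ∫⁻ s in Ioo 0 t, eLpNorm (Φ s) 2 μ := by
  have hbm : Measurable fun s => eLpNorm (Φ s) 2 μ := measurable_eLpNorm_slice hΨ 2
  calc ‖∫ s in Ioo 0 t, ∫ x, ⟪Φ s x, A s x⟫ ∂μ‖ₑ
      ≤ ∫⁻ s in Ioo 0 t, ‖∫ x, ⟪Φ s x, A s x⟫ ∂μ‖ₑ := enorm_integral_le_lintegral_enorm _
    _ ≤ ∫⁻ s in Ioo 0 t, eLpNorm (Φ s) 2 μ * C := by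
        refine lintegral_mono_ae ?_
        filter_upwards [hAC] with s hs
        exact (enorm_integral_inner_le_eLpNorm_mul (hΨ.of_uncurry_left (x := s)).aestronglyMeasurable
          (hA.of_uncurry_left (x := s)).aestronglyMeasurable).trans (mul_le_mul' le_rfl hs)
    _ = C * ∫⁻ s in Ioo 0 t, eLpNorm (Φ s) 2 μ := by
        rw [lintegral_mul_const _ hbm, mul_comm]

/-- **The mollified `L¹`–`L^∞` pairing converges.** Let `A, Φ : ℝ × X → V` be jointly measurable,
`Φ ∈ L¹(0,t; L²(X))` (`∫_{(0,t)} ‖Φ(s)‖₂ ds < ∞`) and `A ∈ L^∞(0,t; L²(X))`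
(`‖A(σ)‖₂ ≤ C < ∞` for a.e. `σ ∈ (0,t)`), and let `ρₙ` be normalised bump kernels with
`rOut(ρₙ) → 0`. Then
`∫∫_{(0,t)²} ρₙ(s - σ) ⟨Φ(s), A(σ)⟩_{L²(X)} dσ ds → ∫_{(0,t)} ⟨Φ(s), A(s)⟩_{L²(X)} ds`
(Serrin 1963, §4, for the pairing of a force `f₀ ∈ L¹(0,T;L²)` — Sohr 2001, Ch. V (1.4.2) — with
a weak solution in `L^∞(0,T;L²)`). Proof: time truncation `Φ_M` of `Φ` at slice-norm level `M`
lies in `L²((0,t) × X)`, so the accepted `L²`–`L²` lemma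
`tendsto_integral_normed_mul_integral_inner` gives the limit for `(Φ_M, A)`; both error terms are
`≤ C ∫_{‖Φ(s)‖₂ > M} ‖Φ(s)‖₂ ds` uniformly in `n` (`enorm_integral_sq_normed_mul_integral_inner_le`),
which tends to `0` as `M → ∞` by dominated convergence. [cite: Serrin1963, §4] -/
theorem tendsto_integral_normed_mul_integral_inner_L1 {φ : ℕ → ContDiffBump (0 : ℝ)}
    (hφ : Tendsto (fun n => (φ n).rOut) atTop (𝓝 0))
    (hA : StronglyMeasurable (uncurry A)) (hΨ : StronglyMeasurable (uncurry Φ))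
    {C : ℝ≥0∞} (hC : C ≠ ⊤) (hAC : ∀ᵐ σ ∂(volume.restrict (Ioo 0 t)), eLpNorm (A σ) 2 μ ≤ C)
    (hΦ1 : ∫⁻ s in Ioo 0 t, eLpNorm (Φ s) 2 μ < ⊤) :
    Tendsto (fun n => ∫ p, (φ n).normed volume (p.2 - p.1) * ∫ x, ⟪Φ p.2 x, A p.1 x⟫ ∂μ
        ∂((volume.restrict (Ioo 0 t)).prod (volume.restrict (Ioo 0 t))))
      atTop (𝓝 (∫ s in Ioo 0 t, ∫ x, ⟪Φ s x, A s x⟫ ∂μ)) := by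
  set νt : Measure ℝ := volume.restrict (Ioo 0 t) with hνt
  haveI : IsFiniteMeasure νt := by rw [hνt]; infer_instance
  have hA2 : eLpNorm (uncurry A) 2 (νt.prod μ) < ⊤ := eLpNorm_uncurry_lt_top_of_ae_slice_le hA hC hAC
  have hbm : Measurable fun s => eLpNorm (Φ s) 2 μ := measurable_eLpNorm_slice hΨ 2
  have hb_fin : ∀ᵐ s ∂νt, eLpNorm (Φ s) 2 μ < ⊤ := ae_lt_top hbm hΦ1.ne
  -- ### the truncations `Φ_M`, `M : ℕ`
  set T : ℕ → ℝ → X → V := fun M s x => if eLpNorm (Φ s) 2 μ ≤ (M : ℝ≥0∞) then Φ s x else 0 with hT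
  set R : ℕ → ℝ → X → V := fun M s x => Φ s x - T M s x with hR
  have hTm : ∀ M, StronglyMeasurable (uncurry (T M)) := fun M =>
    stronglyMeasurable_uncurry_sliceTrunc hΨ (M : ℝ≥0∞)
  have hRm : ∀ M, StronglyMeasurable (uncurry (R M)) := fun M => hΨ.sub (hTm M)
  have hT2 : ∀ M, eLpNorm (uncurry (T M)) 2 (νt.prod μ) < ⊤ := fun M =>
    eLpNorm_uncurry_sliceTrunc_lt_top hΨ hΦ1 (ENNReal.natCast_ne_top M)
  have hTs : ∀ M s, eLpNorm (T M s) 2 μ =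
      if eLpNorm (Φ s) 2 μ ≤ (M : ℝ≥0∞) then eLpNorm (Φ s) 2 μ else 0 :=
    fun M s => eLpNorm_sliceTrunc Φ (M : ℝ≥0∞) s
  have hTle : ∀ M s, eLpNorm (T M s) 2 μ ≤ eLpNorm (Φ s) 2 μ := fun M s => by
    rw [hTs]; split_ifs <;> simp
  -- the remainder slice norms `‖R_M(s)‖₂ = 𝟙{‖Φ(s)‖₂ > M} ‖Φ(s)‖₂`
  set δ : ℕ → ℝ≥0∞ := fun M => ∫⁻ s in Ioo 0 t, eLpNorm (R M s) 2 μ with hδ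
  have hRs : ∀ M s, eLpNorm (R M s) 2 μ = if eLpNorm (Φ s) 2 μ ≤ (M : ℝ≥0∞) then 0 else eLpNorm (Φ s) 2 μ :=
    fun M s => eLpNorm_sub_sliceTrunc Φ (M : ℝ≥0∞) s
  have hRle : ∀ M s, eLpNorm (R M s) 2 μ ≤ eLpNorm (Φ s) 2 μ := fun M s => by
    rw [hRs]; split_ifs <;> simp
  have hR1 : ∀ M, ∫⁻ s in Ioo 0 t, eLpNorm (R M s) 2 μ < ⊤ := fun M =>
    lt_of_le_of_lt (lintegral_mono fun s => hRle M s) hΦ1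
  -- `δ M → 0` by dominated convergence
  have hδ0 : Tendsto δ atTop (𝓝 0) := by
    have hlim : ∀ᵐ s ∂νt, Tendsto (fun M : ℕ => eLpNorm (R M s) 2 μ) atTop (𝓝 0) := by
      filter_upwards [hb_fin] with s hs
      obtain ⟨M₀, hM₀⟩ := ENNReal.exists_nat_gt hs.ne
      refine tendsto_const_nhds.congr' ?_
      filter_upwards [eventually_ge_atTop M₀] with M hM
      rw [hRs, if_pos]
      exact hM₀.le.trans (by exact_mod_cast hM)
    have h := tendsto_lintegral_of_dominated_convergence (μ := νt)
      (F := fun M s => eLpNorm (R M s) 2 μ) (f := fun _ => 0) (fun s => eLpNorm (Φ s) 2 μ)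
      (fun M => measurable_eLpNorm_slice (hRm M) 2)
      (fun M => ae_of_all _ fun s => hRle M s) hΦ1.ne hlim
    simpa using h
  -- ### the truncated limits (accepted `L²`–`L²` lemma)
  set a : ℕ → ℕ → ℝ := fun M n => ∫ p, (φ n).normed volume (p.2 - p.1) *
    ∫ x, ⟪T M p.2 x, A p.1 x⟫ ∂μ ∂(νt.prod νt) with ha
  set aL : ℕ → ℝ := fun M => ∫ s in Ioo 0 t, ∫ x, ⟪T M s x, A s x⟫ ∂μ with haL
  set b : ℕ → ℝ := fun n => ∫ p, (φ n).normed volume (p.2 - p.1) *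
    ∫ x, ⟪Φ p.2 x, A p.1 x⟫ ∂μ ∂(νt.prod νt) with hb
  set bL : ℝ := ∫ s in Ioo 0 t, ∫ x, ⟪Φ s x, A s x⟫ ∂μ with hbL
  have hmain : ∀ M, Tendsto (a M) atTop (𝓝 (aL M)) := by
    intro M
    have h1 := tendsto_integral_normed_mul_integral_inner (μ := μ) hφ hA (hTm M) hA2 (hT2 M)
    have hint : Integrable (fun z : ℝ × X => ⟪T M z.1 z.2, A z.1 z.2⟫) (νt.prod μ) :=
      integrable_inner_of_eLpNorm_two_lt_top (hTm M).aestronglyMeasurable hA.aestronglyMeasurable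
        (hT2 M) hA2
    have hR : (∫ z, ⟪T M z.1 z.2, A z.1 z.2⟫ ∂(νt.prod μ)) = aL M := by
      rw [haL, integral_prod _ hint]
    rw [hR] at h1
    exact h1
  -- ### the error bounds, uniform in `n`
  have hT1 : ∀ M, ∫⁻ s in Ioo 0 t, eLpNorm (T M s) 2 μ < ⊤ := fun M =>
    lt_of_le_of_lt (lintegral_mono fun s => hTle M s) hΦ1
  have herr : ∀ M n, ‖b n - a M n‖ₑ ≤ C * δ M := by
    intro M n
    have iΦ := integrable_sq_normed_mul_integral_inner_L1 (μ := μ) (φ n) hA hΨ hC hAC hΦ1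
    have iT := integrable_sq_normed_mul_integral_inner_L1 (μ := μ) (φ n) hA (hTm M) hC hAC (hT1 M)
    have hsub : b n - a M n = ∫ p, (φ n).normed volume (p.2 - p.1) *
        ∫ x, ⟪R M p.2 x, A p.1 x⟫ ∂μ ∂(νt.prod νt) := by
      rw [hb, ha]
      dsimp only
      rw [← integral_sub iΦ iT]
      refine integral_congr_ae ?_
      have h1 : ∀ᵐ p ∂(νt.prod νt), eLpNorm (Φ p.2) 2 μ < ⊤ :=
        (Measure.quasiMeasurePreserving_snd (μ := νt) (ν := νt)).ae hb_fin
      have h2 : ∀ᵐ p ∂(νt.prod νt), eLpNorm (A p.1) 2 μ ≤ C :=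
        (Measure.quasiMeasurePreserving_fst (μ := νt) (ν := νt)).ae hAC
      filter_upwards [h1, h2] with p hp1 hp2
      have mΦ : MemLp (Φ p.2) 2 μ := ⟨(hΨ.of_uncurry_left (x := p.2)).aestronglyMeasurable, hp1⟩
      have mT : MemLp (T M p.2) 2 μ :=
        ⟨((hTm M).of_uncurry_left (x := p.2)).aestronglyMeasurable, (hTle M p.2).trans_lt hp1⟩
      have mA : MemLp (A p.1) 2 μ := ⟨(hA.of_uncurry_left (x := p.1)).aestronglyMeasurable,
        lt_of_le_of_lt hp2 hC.lt_top⟩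
      rw [← mul_sub, ← integral_sub (integrable_inner_of_eLpNorm_two_lt_top mΦ.1 mA.1 mΦ.2 mA.2)
        (integrable_inner_of_eLpNorm_two_lt_top mT.1 mA.1 mT.2 mA.2)]
      congr 1
      refine integral_congr_ae (ae_of_all _ fun x => ?_)
      simp only [hR, inner_sub_left]
    rw [hsub]
    exact enorm_integral_sq_normed_mul_integral_inner_le (φ n) hA (hRm M) hAC
  have herrL : ∀ M, ‖bL - aL M‖ₑ ≤ C * δ M := by
    intro M
    have iΦ := integrableOn_integral_inner_L1 (μ := μ) hA hΨ hC hAC hΦ1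
    have iT := integrableOn_integral_inner_L1 (μ := μ) hA (hTm M) hC hAC (hT1 M)
    have hsub : bL - aL M = ∫ s in Ioo 0 t, ∫ x, ⟪R M s x, A s x⟫ ∂μ := by
      rw [hbL, haL, ← integral_sub iΦ iT]
      refine integral_congr_ae ?_
      filter_upwards [hb_fin, hAC] with s hs1 hs2
      have mΦ : MemLp (Φ s) 2 μ := ⟨(hΨ.of_uncurry_left (x := s)).aestronglyMeasurable, hs1⟩
      have mT : MemLp (T M s) 2 μ :=
        ⟨((hTm M).of_uncurry_left (x := s)).aestronglyMeasurable, (hTle M s).trans_lt hs1⟩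
      have mA : MemLp (A s) 2 μ := ⟨(hA.of_uncurry_left (x := s)).aestronglyMeasurable,
        lt_of_le_of_lt hs2 hC.lt_top⟩
      rw [← integral_sub (integrable_inner_of_eLpNorm_two_lt_top mΦ.1 mA.1 mΦ.2 mA.2)
        (integrable_inner_of_eLpNorm_two_lt_top mT.1 mA.1 mT.2 mA.2)]
      refine integral_congr_ae (ae_of_all _ fun x => ?_)
      simp only [hR, inner_sub_left]
    rw [hsub]
    exact enorm_integral_integral_inner_le hA (hRm M) hAC
  -- ### the `ε/3` argument
  rw [Metric.tendsto_atTop]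
  intro ε hε
  -- choose `M` with `C * δ M < ε / 3`
  have hε3 : (0 : ℝ≥0∞) < ENNReal.ofReal (ε / 3) := ENNReal.ofReal_pos.2 (by linarith)
  have hCδ : Tendsto (fun M => C * δ M) atTop (𝓝 0) := by
    have h := ENNReal.Tendsto.const_mul hδ0 (Or.inr hC)
    rwa [mul_zero] at h
  obtain ⟨M, hM⟩ := (hCδ.eventually (gt_mem_nhds hε3)).exists
  -- then `N` from the truncated limit
  obtain ⟨N, hN⟩ := (Metric.tendsto_atTop.1 (hmain M)) (ε / 3) (by linarith)
  refine ⟨N, fun n hn => ?_⟩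
  have e1 : dist (b n) (a M n) < ε / 3 := by
    rw [dist_eq_norm, ← toReal_enorm]
    have hlt : ‖b n - a M n‖ₑ < ENNReal.ofReal (ε / 3) := (herr M n).trans_lt hM
    exact ENNReal.toReal_lt_of_lt_ofReal hlt
  have e3 : dist (aL M) bL < ε / 3 := by
    rw [dist_comm, dist_eq_norm, ← toReal_enorm]
    have hlt : ‖bL - aL M‖ₑ < ENNReal.ofReal (ε / 3) := (herrL M).trans_lt hM
    exact ENNReal.toReal_lt_of_lt_ofReal hlt
  calc dist (b n) bL ≤ dist (b n) (a M n) + dist (a M n) (aL M) + dist (aL M) bL :=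
        dist_triangle4 _ _ _ _
    _ < ε / 3 + ε / 3 + ε / 3 := by gcongr; exact hN n hn
    _ = ε := by ring

end L1Linfty

end Literature.Analysis.FunctionSpaces

end
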